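import Mathlib
import Summits.Ventures.PercRepro2.Independence
import Summits.Ventures.PercRepro2.Harris
import Summits.Ventures.PercRepro2.HCov
import Summits.Ventures.PercRepro2.CutVertexPaths
import Summits.Ventures.PercRepro2.CutOneFarConn
import Summits.Ventures.PercRepro2.CutTwoFarConn
import Summits.Ventures.PercRepro2.CutTwoFarLaw
import Summits.Ventures.PercRepro2.CutTwoFar
import Summits.Ventures.PercRepro2.CutTwoFarHarris
import Summits.Ventures.PercRepro2.CutTwoFarRootsLaw
import Summits.Ventures.PercRepro2.CutTwoFarRightPat
import Summits.Ventures.PercRepro2.PendantB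
import Summits.Ventures.PercRepro2.RowCert
import Summits.Ventures.PercRepro2.CutTwoFarABConn
import Summits.Ventures.PercRepro2.CutTwoFarABMasses

/-!
# `a₃` and `b` behind a cut vertex, III: THE PENDANT-AT-`b` REDUCTION (blind cell PercRepro2,
typer-1 g50)

The class theorem T4 of MINE2-CUTVERTEX.md §13.2 (S3.5, the role pair `{a₃, b}`) in the kernel:
with `v` a cut vertex, `a₃, b` on the left and `o, a₁, a₂` on the right (or at `v`),

  `Gc = P_A(b ↔ v) · rowPoly(a₁, a₂, o, v; t)`,  `t = P_A(a₃ ↔ v)`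

(**`Gc_a3bFar_eq`**) — the joint law of `(a₃, b)` in the part does NOT enter, only the two
marginals, and `rowPoly` is the cleared cubic of `PendantB.Row` (the instance `o, a₁, a₂` with
`b := v` and a leaf `a₃` at `v` of weight `t`).  Hence (HCOV) on the whole class (**`HCov_a3bFar`**)
from `RowCert.row_nonneg` (the tenth class, `PendantB.Row` for every leaf weight).  Proof: the
bilinear forms of Part II, `∑ q = 1`, `∑ r = 1`, and `ring`.  Own work; standard axioms.
-/

namespace Summit.Ventures.PercRepro2

open CovForm CutVertexM9 UnionCluster

namespace CutTwoFar

section ABFar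

variable {V : Type*} {E : Type*} [Fintype E] [DecidableEq E] {R : Type*} [Field R]
variable {ends : E → Sym2 V} {side : E → Bool} {L : Set V} {v : V} {Rt : Set V}

/-- The cleared cubic of `PendantB.Row` as a function: `Row p ends a₁ a₂ o b q ↔ 0 ≤ rowPoly … q`. -/
noncomputable def rowPoly (p : E → R) (ends : E → Sym2 V) (a₁ a₂ o b : V) (q : R) : R :=
  let Q := avoidAll ends a₂ {a₁}
  let P := prob p Q
  let bL := prob p (Q ∩ connEvent ends a₁ b)
  let bH := prob p (Q ∩ connEvent ends a₂ b)
  let oL := prob p (Q ∩ connEvent ends a₁ o)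
  let oH := prob p (Q ∩ connEvent ends a₂ o)
  let A := prob p (Q ∩ (connEvent ends a₁ o ∩ connEvent ends a₁ b))
  let B := prob p (Q ∩ (connEvent ends a₂ o ∩ connEvent ends a₂ b))
  let C := prob p (Q ∩ (connEvent ends a₂ o ∩ connEvent ends a₁ b))
  let Dd := prob p (Q ∩ (connEvent ends a₁ o ∩ connEvent ends a₂ b))
  let Sb := bL - bH
  let So := oL - oH
  let mbU := bL + bH
  let moU := oL + oH
  let Sig := A + B + C + Dd
  let Ebo := (A + C) - (Dd + B)
  let EQbo := A + B - C - Dd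
  let CovC := P * EQbo - Sb * So
  CovC * (P - q * mbU) - (1 - q) * (P ^ 2 * Sig - P * moU * mbU) +
      q * (moU - q * Sig) * (P * mbU - Sb ^ 2) - q * (P - q * mbU) * (P * Sig - Sb * Ebo)

/-- `PendantB.Row` is the nonnegativity of `rowPoly`. -/
lemma row_iff_rowPoly [LinearOrder R] (p : E → R) (ends : E → Sym2 V) (a₁ a₂ o b : V) (q : R) :
    PendantB.Row p ends a₁ a₂ o b q ↔ 0 ≤ rowPoly p ends a₁ a₂ o b q :=
  Iff.rfl

variable (h : CutVertex ends side L v Rt) {o b a₁ a₂ a₃ : V} (p : E → R)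
include h

/-- **T4 — THE PENDANT-AT-`b` REDUCTION** (MINE2-CUTVERTEX §13.2; S3.5 `{a₃, b}`): with `a₃, b`
behind the cut vertex `v`, `Gc = P_A(b ↔ v) · rowPoly(a₁, a₂, o, v; P_A(a₃ ↔ v))` —
`P_A(b ↔ v) = q_all + q_x2`, `P_A(a₃ ↔ v) = q_all + q_x1`. -/
theorem Gc_a3bFar_eq (h3 : a₃ ∈ L ∨ a₃ = v) (hb : b ∈ L ∨ b = v) (h1 : a₁ ∈ Rt ∨ a₁ = v)
    (h2 : a₂ ∈ Rt ∨ a₂ = v) (ho : o ∈ Rt ∨ o = v) : Gc p ends o a₁ a₂ a₃ b =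
    (patProb ends side v a₃ b p ![true, true, true] + patProb ends side v a₃ b p ![false, true, false]) * rowPoly p ends a₁ a₂ o v (patProb ends side v a₃ b p ![true, true, true] + patProb ends side v a₃ b p ![true, false, false]) := by
  have hq := sum_patProb_transPatterns ends side v a₃ b p
  rw [sum_transPatterns] at hq
  have hr := ratom_sum_transSix ends side v a₁ a₂ o p
  rw [sum_transSix] at hr
  have hqs : patProb ends side v a₃ b p ![false, false, false] = 1 - (patProb ends side v a₃ b p ![true, true, true] + patProb ends side v a₃ b p ![true, false, false] + patProb ends side v a₃ b p ![false, true, false] + patProb ends side v a₃ b p ![false, false, true]) := by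
    linear_combination hq
  have hrs : ratom ends side v a₁ a₂ o p ![false, false, false, false, false, false] = 1 - (ratom ends side v a₁ a₂ o p ![true, true, true, true, true, true] + ratom ends side v a₁ a₂ o p ![true, true, false, true, false, false] + ratom ends side v a₁ a₂ o p ![true, false, true, false, true, false] + ratom ends side v a₁ a₂ o p ![true, false, false, false, false, true] + ratom ends side v a₁ a₂ o p ![true, false, false, false, false, false] + ratom ends side v a₁ a₂ o p ![false, true, true, false, false, true] + ratom ends side v a₁ a₂ o p ![false, true, false, false, true, false] + ratom ends side v a₁ a₂ o p ![false, true, false, false, false, false] + ratom ends side v a₁ a₂ o p ![false, false, true, true, false, false] + ratom ends side v a₁ a₂ o p ![false, false, true, false, false, false] + ratom ends side v a₁ a₂ o p ![false, false, false, true, true, true] + ratom ends side v a₁ a₂ o p ![false, false, false, true, false, false] + ratom ends side v a₁ a₂ o p ![false, false, false, false, true, false] + ratom ends side v a₁ a₂ o p ![false, false, false, false, false, true]) := by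
    linear_combination hr
  simp only [Gc, DEF, rowPoly]
  rw [PQ_ab h p h1 h2,
    D_ab h p h3 h1 h2,
    Do_ab h p h3 h1 h2 ho,
    EQbo_ab h p hb h1 h2 ho,
    EQb3_ab h p h3 hb h1 h2,
    EQb3o_ab h p h3 hb h1 h2 ho,
    gap_ab h p hb h1 h2,
    EQo_ab h p h1 h2 ho,
    EQ3_ab h p h3 h1 h2,
    EQ3o_ab h p h3 h1 h2 ho,
    PDb_ab h p h3 hb h1 h2,
    PDbo_ab h p h3 hb h1 h2 ho,
    rbL h p h1 h2,
    rbH h p h1 h2,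
    roL h p h1 h2 ho,
    roH h p h1 h2 ho,
    rA h p h1 h2 ho,
    rB h p h1 h2 ho,
    rC h p h1 h2 ho,
    rD h p h1 h2 ho, hqs, hrs]
  ring

/-- **(HCOV) with `a₃` and `b` behind a cut vertex**, every admissible weight vector: the
pendant-at-`b` theorem `RowCert.row_nonneg` at the leaf weight `P_A(a₃ ↔ v)`. -/
theorem HCov_a3bFar [Fintype V] [DecidableEq V] [LinearOrder R] [IsStrictOrderedRing R]
    (h3 : a₃ ∈ L ∨ a₃ = v) (hb : b ∈ L ∨ b = v) (h1 : a₁ ∈ Rt ∨ a₁ = v) (h2 : a₂ ∈ Rt ∨ a₂ = v)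
    (ho : o ∈ Rt ∨ o = v) (hp : IsProbVec p) : HCov p ends o a₁ a₂ a₃ b := by
  unfold HCov
  rw [Gc_a3bFar_eq h p h3 hb h1 h2 ho]
  have hq : ∀ τ, 0 ≤ patProb ends side v a₃ b p τ := fun τ => prob_nonneg hp _
  have ht1 : patProb ends side v a₃ b p ![true, true, true] + patProb ends side v a₃ b p ![true, false, false] ≤ 1 := by
    rw [← prob_L₁_eq]
    exact prob_le_one hp _
  have hrow := (row_iff_rowPoly p ends a₁ a₂ o v _).1
    (RowCert.row_nonneg p hp ends a₁ a₂ o v _ (add_nonneg (hq _) (hq _)) ht1)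
  exact mul_nonneg (add_nonneg (hq _) (hq _)) hrow

end ABFar

end CutTwoFar

end Summit.Ventures.PercRepro2
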